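import Summits.Ventures.LatticeQCDFlow.Scaling.ReplicaExchangeModeGap
import Summits.Ventures.LatticeQCDFlow.Scaling.TemperingLikelihoodRatio

/-!
HONEST FRAMING: exact (Metropolis-corrected) sampling algorithms for lattice gauge theory; figures
of merit are autocorrelation/cost numbers at stated couplings and volumes; no continuum-physics
claim.

# ReplicaExchangeModeRatio — THE HYPOTHESES OF CHAPTER R FROM ADJACENT LIKELIHOOD RATIOS: `μ_{l+1} ≤ e^{r}μ_l`,
# `μ_l ≤ e^{r}μ_{l+1}` POINTWISE ⇒ ASSIGNMENT-RESTRICTED SWAP OVERLAPS `δ₂ = e^{−2r}`, ONE-LEVEL COOLING `q = e^{−r}`,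
# PERSISTENCE `p = e^{−Kr}`; HENCE FOR THE EXPONENTIAL FAMILY `w·e^{βX}/Z` WITH STEPS `≤ Δ` AND OSCILLATION `≤ R`:
# `τ_int(g) ≤ 96(K+1)²·e^{2KΔR}/(γ_A·min{e^{−2ΔR}/K², γ₀/(K+1)}) − ½` FOR EVERY OBSERVABLE (lean-2 GEN-18, ours)

Venture-side (OURS).  Cell `lqcd-flow` (pub-lqcd), unit `pub-lqcd-lean-2-g18`, 2026-08-25.  Chapter R, file 4 — the
replica-exchange counterpart of `Scaling/TemperingLikelihoodRatio` + `Scaling/SimulatedTemperingModeExpFamily` (GEN-17,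
chapter Y/Z for simulated tempering): the three ladder hypotheses of `Scaling/ReplicaExchangeModeGap` (persistence
`p`, cooling `q`, assignment-restricted swap overlap `δ₂`) discharged from POINTWISE adjacent likelihood-ratio bounds,
with no structural input about the modes.  The two remaining hypotheses (within-mode gaps `γ_A`, the hot replica's gap
between modes `γ₀`) are the genuine model input.

## What is proved

* §1 under `μ_{l+1}(x) ≤ e^{r}μ_l(x)`, `μ_l(x) ≤ e^{r}μ_{l+1}(x)` (`r ≥ 0`, `μ ≥ 0`): **`tensorFun_comp_levelSwap_ge`** —
  `π̃(x∘σ_l) ≥ e^{−2r}·π̃(x)`; **`ladderRatio_hδ₂`** — `e^{−2r}·min{π̄(m), π̄(m∘σ_l)} ≤ Σ_{mode∘x = m} min{π̃(x), π̃(x∘σ_l)}`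
  for EVERY mode partition and every assignment; **`ladderRatio_hq`** — `e^{−r}·ν_l(j) ≤ ν_{l+1}(j)`; persistence
  `e^{−Kr}` is `Scaling/TemperingLikelihoodRatio.ladderRatio_hpers`.
* §2 **`ptBareModeRatio_tauInt_le`** — chapter R's ceiling with these constants:
  `τ_int(g) ≤ 96(K+1)²/(e^{−Kr}·e^{−Kr}·γ_A·min{e^{−2r}/K², γ₀/(K+1)}) − ½` at `t = ½`, every observable, every mode
  partition for which `γ_A`, `γ₀` hold.
* §3 the exponential family `μ_k = w·e^{β_k X}/Z(β_k)` with `|β_{l+1} − β_l| ≤ Δ`, `|X(x) − X(y)| ≤ R`: `r = ΔR`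
  (`Scaling/TemperingLikelihoodRatio.expFamily_adjacent_ratio`) ⇒ **`ptBareModeExpFamily_tauInt_le`**.
* §4 **`ptBareModeUnitWindow_tauInt_le`** — a uniform ladder over a unit window (`Δ = 1/K`, e.g. a boundary coupling
  `c ∈ [0,1]` on a defect term of oscillation `R`): `τ_int ≤ 96(K+1)²·e^{2R}/(γ_A·min{e^{−2R/K}/K², γ₀/(K+1)}) − ½` —
  exponential only in the DEFECT's action range, polynomial in the number of replicas.

Reading (no numerics implied): without structural input the replica-exchange ceiling is polynomial in the number of
replicas and exponential only in (window of couplings) × (oscillation of the action), exactly like the simulated-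
tempering ceiling of chapter Y; sector weights of lattice gauge theory are expected to persist far better (model input,
NOT CLAIMED).  NOT CLAIMED: anything measured; general configuration spaces.  Literature grade (cell rule): ELEMENTARY
(likelihood-ratio bookkeeping), NEW TYPING; nothing cited as a fact; no new bib keys.
-/

noncomputable section

open Finset Function
open Real (exp exp_add exp_le_one_iff exp_nat_mul exp_pos exp_zero)
open Literature.Probability.MarkovChains
open Literature.Probability.MarkovChains.Decomposition

namespace Summit.Ventures.LatticeQCDFlow.Scaling

variable {S J : Type*} [Fintype S] [DecidableEq S] [Fintype J] [DecidableEq J] {K : ℕ}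
  {μ : Fin (K + 1) → S → ℝ} {mode : S → J}

/-! ## §1 Adjacent likelihood ratios ⇒ `δ₂ = e^{−2r}`, `q = e^{−r}` -/

section Ratio

variable {r : ℝ} (hr0 : 0 ≤ r) (hμ0 : ∀ k x, 0 ≤ μ k x)
  (hr : ∀ (l : Fin K) (x : S), μ l.succ x ≤ exp r * μ l.castSucc x ∧ μ l.castSucc x ≤ exp r * μ l.succ x)
include hr0 hμ0 hr

omit [Fintype S] [DecidableEq S] [Fintype J] [DecidableEq J] in
/-- **A swap costs at most `e^{2r}` in weight:** `e^{−2r}·π̃(x) ≤ π̃(x∘σ_l)`. [ours] -/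
theorem tensorFun_comp_levelSwap_ge (x : Fin (K + 1) → S) (l : Fin K) :
    exp (-(2 * r)) * tensorFun μ x ≤ tensorFun μ (x ∘ levelSwap l) := by
  have hcs : l.castSucc ≠ l.succ := fun e => by have := congrArg Fin.val e; simp at this
  have he1 : exp (-r) ≤ 1 := by rw [exp_le_one_iff]; linarith
  have hinv : ∀ {a b : ℝ}, a ≤ exp r * b → exp (-r) * a ≤ b := by
    intro a b h
    have := mul_le_mul_of_nonneg_left h (exp_pos (-r)).le
    rwa [← mul_assoc, ← exp_add, show -r + r = 0 by ring, exp_zero, one_mul] at this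
  -- reindex `π̃(x)` along the swap and compare factor by factor
  set c : Fin (K + 1) → ℝ := fun k => (if k = l.castSucc then exp (-r) else 1) * (if k = l.succ then exp (-r) else 1)
    with hc
  have hprodc : ∏ k, c k = exp (-(2 * r)) := by
    rw [hc, prod_mul_distrib, prod_ite_eq', prod_ite_eq']
    simp only [mem_univ, if_true]
    rw [← exp_add]; ring_nf
  have hreindex : tensorFun μ x = ∏ k, μ (levelSwap l k) (x (levelSwap l k)) := by
    unfold tensorFun
    exact (Equiv.prod_comp (levelSwap l) (fun k => μ k (x k))).symm
  have hterm : ∀ k, c k * μ (levelSwap l k) (x (levelSwap l k)) ≤ μ k (x (levelSwap l k)) := by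
    intro k
    by_cases h1 : k = l.castSucc
    · subst h1
      rw [hc]; simp only [if_true, if_neg hcs, mul_one]
      rw [levelSwap_castSucc]
      exact hinv (hr l (x l.succ)).1
    · by_cases h2 : k = l.succ
      · subst h2
        rw [hc]; simp only [if_neg (Ne.symm hcs), if_true, one_mul]
        have e : levelSwap l l.succ = l.castSucc := by unfold levelSwap; exact Equiv.swap_apply_right _ _
        rw [e]
        exact hinv (hr l (x l.castSucc)).2
      · have e : levelSwap l k = k := by unfold levelSwap; exact Equiv.swap_apply_of_ne_of_ne h1 h2
        rw [hc]; simp only [if_neg h1, if_neg h2, one_mul]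
        rw [e]
  calc exp (-(2 * r)) * tensorFun μ x = ∏ k, c k * μ (levelSwap l k) (x (levelSwap l k)) := by
        rw [hreindex, ← hprodc, ← prod_mul_distrib]
    _ ≤ ∏ k, μ k (x (levelSwap l k)) := by
        refine prod_le_prod (fun k _ => mul_nonneg ?_ (hμ0 _ _)) fun k _ => hterm k
        rw [hc]; positivity
    _ = tensorFun μ (x ∘ levelSwap l) := rfl

omit [DecidableEq S] [Fintype J] in
/-- **`hδ` of chapter R with `δ₂ = e^{−2r}`:** for every mode partition, every assignment `m` and every pair,
`e^{−2r}·min{π̄(m), π̄(m∘σ_l)} ≤ Σ_{mode∘x = m} min{π̃(x), π̃(x∘σ_l)}`. [ours] -/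
theorem ladderRatio_hδ₂ (m : Fin (K + 1) → J) (l : Fin K) :
    exp (-(2 * r)) * min (blockMass (tensorFun μ) (fun z : Fin (K + 1) → S => mode ∘ z) m)
        (blockMass (tensorFun μ) (fun z : Fin (K + 1) → S => mode ∘ z) (m ∘ levelSwap l))
      ≤ ∑ x ∈ block (fun z : Fin (K + 1) → S => mode ∘ z) m, min (tensorFun μ x) (tensorFun μ (x ∘ levelSwap l)) := by
  have he1 : exp (-(2 * r)) ≤ 1 := by rw [exp_le_one_iff]; linarith
  have hT0 : ∀ x, 0 ≤ tensorFun μ x := fun x => prod_nonneg fun k _ => hμ0 _ _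
  calc exp (-(2 * r)) * min (blockMass (tensorFun μ) (fun z : Fin (K + 1) → S => mode ∘ z) m)
        (blockMass (tensorFun μ) (fun z : Fin (K + 1) → S => mode ∘ z) (m ∘ levelSwap l))
      ≤ exp (-(2 * r)) * blockMass (tensorFun μ) (fun z : Fin (K + 1) → S => mode ∘ z) m :=
        mul_le_mul_of_nonneg_left (min_le_left _ _) (exp_pos _).le
    _ = ∑ x ∈ block (fun z : Fin (K + 1) → S => mode ∘ z) m, exp (-(2 * r)) * tensorFun μ x := by
        unfold blockMass; rw [mul_sum]
    _ ≤ _ := sum_le_sum fun x _ => le_min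
        ((mul_le_mul_of_nonneg_right he1 (hT0 x)).trans_eq (one_mul _))
        (tensorFun_comp_levelSwap_ge hr0 hμ0 hr x l)

omit [DecidableEq S] [Fintype J] hr0 hμ0 in
/-- **`hq` of chapter R with `q = e^{−r}`:** `e^{−r}·μ_l(A_j) ≤ μ_{l+1}(A_j)` for every mode. [ours] -/
theorem ladderRatio_hq (l : Fin K) (j : J) :
    exp (-r) * blockMass (μ l.castSucc) mode j ≤ blockMass (μ l.succ) mode j := by
  unfold blockMass
  rw [mul_sum]
  refine sum_le_sum fun x _ => ?_
  have h := mul_le_mul_of_nonneg_left (hr l x).2 (exp_pos (-r)).le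
  rwa [← mul_assoc, ← exp_add, show -r + r = 0 by ring, exp_zero, one_mul] at h

end Ratio

/-! ## §2 Chapter R's ceiling from likelihood ratios -/

section Ceiling

variable (hμ : ∀ k x, 0 < μ k x) (hμ1 : ∀ k, ∑ x, μ k x = 1) (hmode : Function.Surjective mode)
  {M : Fin (K + 1) → S → S → ℝ}

include hμ hμ1 hmode in
/-- **`τ_int(g) ≤ 96(K+1)²/(e^{−Kr}·(e^{−r})^K·γ_A·min{e^{−2r}/K², γ₀/(K+1)}) − ½`** at `t = ½` for every non-constant
observable, from adjacent likelihood ratios `e^{±r}` (`0 ≤ r`, `2r ≤ 1` is NOT needed: `e^{−2r} ≤ 1` always), within-mode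
gaps `γ_A` and the hot replica's mode-projection gap `γ₀`. [ours] -/
theorem ptBareModeRatio_tauInt_le [Nontrivial S] (hK : 1 ≤ K) (hM : ∀ k, IsRowStochastic (M k))
    (hMrev : ∀ k, DetailedBalance (μ k) (M k)) (hMirr : ∀ k, IsIrreducible (M k))
    {r γ₀ γA : ℝ} (hr0 : 0 ≤ r)
    (hr : ∀ (l : Fin K) (x : S), μ l.succ x ≤ exp r * μ l.castSucc x ∧ μ l.castSucc x ≤ exp r * μ l.succ x)
    (hγ₀ : 0 < γ₀) (hγA : 0 < γA) (hγA1 : γA ≤ 1)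
    (hgap0 : ∀ h : J → ℝ, γ₀ * lawVariance (blockMass (μ 0) mode) h
      ≤ dirichletForm (blockMass (μ 0) mode) (projectionChain (μ 0) (M 0) mode) h)
    (hgapA : ∀ k j, ∀ h : S → ℝ, γA * lawVariance (blockLaw (μ k) mode j) h
      ≤ dirichletForm (blockLaw (μ k) mode j) (restrictionChain (M k) mode) h)
    {g : (Fin (K + 1) → S) → ℝ} (hg : 0 < lawVariance (tensorFun μ) g) :
    asympVar g (tensorFun μ) (ptBareSampler (1 / 2) μ M) / (2 * lawVariance (tensorFun μ) g)
      ≤ 96 * (K + 1) ^ 2 / (exp (-(K * r)) * exp (-r) ^ K * γA * min (exp (-(2 * r)) / K ^ 2) (γ₀ / (K + 1)))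
          - 1 / 2 :=
  ptBareModeHalf_tauInt_le hμ hμ1 hmode hK hM hMrev hMirr (exp_pos _) (by rw [exp_le_one_iff]; nlinarith)
    (exp_pos _) (by rw [exp_le_one_iff]; linarith) (exp_pos _) (by rw [exp_le_one_iff]; linarith) hγ₀ hγA hγA1
    (fun i k j hik => ladderRatio_hpers hr0 (fun k x => (hμ k x).le) hr mode i k j hik)
    (fun l j => ladderRatio_hq hr l j)
    (fun m l _ => ladderRatio_hδ₂ hr0 (fun k x => (hμ k x).le) hr m l) hgap0 hgapA hg

end Ceiling

/-! ## §3 The exponential family -/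

section ExpFamily

variable {w X : S → ℝ} {R Δ : ℝ} {β : Fin (K + 1) → ℝ} (hw : ∀ x, 0 < w x) (hX : ∀ x y, |X x - X y| ≤ R)
  (hμZ : ∀ k x, μ k x = w x * exp (β k * X x) / ∑ y, w y * exp (β k * X y))
  (hβ : ∀ l : Fin K, |β l.succ - β l.castSucc| ≤ Δ)
  (hμ1 : ∀ k, ∑ x, μ k x = 1) (hmode : Function.Surjective mode) {M : Fin (K + 1) → S → S → ℝ}
include hw hX hμZ hβ hμ1 hmode

/-- **THE EXPONENTIAL FAMILY:** for `μ_k = w·e^{β_k X}/Z(β_k)` with `|β_{l+1} − β_l| ≤ Δ` and `|X(x) − X(y)| ≤ R`,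
`τ_int(g) ≤ 96(K+1)²/(e^{−KΔR}·(e^{−ΔR})^K·γ_A·min{e^{−2ΔR}/K², γ₀/(K+1)}) − ½` at `t = ½` for every non-constant
observable: polynomial in the number of replicas, exponential only in (window `KΔ`) × (oscillation `R`). [ours] -/
theorem ptBareModeExpFamily_tauInt_le [Nontrivial S] (hK : 1 ≤ K) (hM : ∀ k, IsRowStochastic (M k))
    (hMrev : ∀ k, DetailedBalance (μ k) (M k)) (hMirr : ∀ k, IsIrreducible (M k))
    {γ₀ γA : ℝ} (hγ₀ : 0 < γ₀) (hγA : 0 < γA) (hγA1 : γA ≤ 1)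
    (hgap0 : ∀ h : J → ℝ, γ₀ * lawVariance (blockMass (μ 0) mode) h
      ≤ dirichletForm (blockMass (μ 0) mode) (projectionChain (μ 0) (M 0) mode) h)
    (hgapA : ∀ k j, ∀ h : S → ℝ, γA * lawVariance (blockLaw (μ k) mode j) h
      ≤ dirichletForm (blockLaw (μ k) mode j) (restrictionChain (M k) mode) h)
    {g : (Fin (K + 1) → S) → ℝ} (hg : 0 < lawVariance (tensorFun μ) g) :
    asympVar g (tensorFun μ) (ptBareSampler (1 / 2) μ M) / (2 * lawVariance (tensorFun μ) g)
      ≤ 96 * (K + 1) ^ 2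
          / (exp (-(K * (Δ * R))) * exp (-(Δ * R)) ^ K * γA * min (exp (-(2 * (Δ * R))) / K ^ 2) (γ₀ / (K + 1)))
        - 1 / 2 := by
  haveI : Nonempty S := by
    by_contra h
    rw [not_nonempty_iff] at h
    have := hμ1 0
    rw [Finset.univ_eq_empty, Finset.sum_empty] at this
    exact zero_ne_one this
  exact ptBareModeRatio_tauInt_le (expFamily_pos hw hμZ) hμ1 hmode hK hM hMrev hMirr
    (expFamily_step_nonneg hX hβ (by omega)) (expFamily_adjacent_ratio hw hX hμZ hβ) hγ₀ hγA hγA1 hgap0 hgapA hg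

/-! ## §4 A uniform ladder over a unit window: tempering in a boundary coupling -/

omit hβ in
/-- **UNIFORM LADDER OVER A UNIT WINDOW** (`|β_{l+1} − β_l| ≤ 1/K`, e.g. `K+1` equally spaced boundary couplings
`c ∈ [0,1]` multiplying a DEFECT term `X` of oscillation `≤ R` in the action, the bulk weight `w` arbitrary): at
`t = ½`, for every non-constant observable,
`τ_int(g) ≤ 96(K+1)²/(e^{−R}·e^{−R}·γ_A·min{e^{−2R/K}/K², γ₀/(K+1)}) − ½` — exponential only in the oscillation `R` of
the tempered term (the defect), polynomial in the number of replicas, and independent of everything else except through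
`γ_A` (within-sector relaxation) and `γ₀` (the `c = β_0` end's relaxation between sectors). [ours] -/
theorem ptBareModeUnitWindow_tauInt_le [Nontrivial S] (hK : 1 ≤ K) (hM : ∀ k, IsRowStochastic (M k))
    (hMrev : ∀ k, DetailedBalance (μ k) (M k)) (hMirr : ∀ k, IsIrreducible (M k))
    (hβK : ∀ l : Fin K, |β l.succ - β l.castSucc| ≤ 1 / K)
    {γ₀ γA : ℝ} (hγ₀ : 0 < γ₀) (hγA : 0 < γA) (hγA1 : γA ≤ 1)
    (hgap0 : ∀ h : J → ℝ, γ₀ * lawVariance (blockMass (μ 0) mode) h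
      ≤ dirichletForm (blockMass (μ 0) mode) (projectionChain (μ 0) (M 0) mode) h)
    (hgapA : ∀ k j, ∀ h : S → ℝ, γA * lawVariance (blockLaw (μ k) mode j) h
      ≤ dirichletForm (blockLaw (μ k) mode j) (restrictionChain (M k) mode) h)
    {g : (Fin (K + 1) → S) → ℝ} (hg : 0 < lawVariance (tensorFun μ) g) :
    asympVar g (tensorFun μ) (ptBareSampler (1 / 2) μ M) / (2 * lawVariance (tensorFun μ) g)
      ≤ 96 * (K + 1) ^ 2
          / (exp (-R) * exp (-R) * γA * min (exp (-(2 * (R / K))) / K ^ 2) (γ₀ / (K + 1))) - 1 / 2 := by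
  have hK0 : (0 : ℝ) < K := by exact_mod_cast hK
  have h := ptBareModeExpFamily_tauInt_le (Δ := 1 / K) hw hX hμZ hβK hμ1 hmode hK hM hMrev hMirr hγ₀ hγA hγA1
    hgap0 hgapA hg
  have e1 : (K : ℝ) * (1 / K * R) = R := by field_simp
  have e2 : exp (-(1 / (K : ℝ) * R)) ^ K = exp (-R) := by
    rw [← Real.exp_nat_mul]; congr 1; field_simp
  have e3 : (2 : ℝ) * (1 / K * R) = 2 * (R / K) := by ring
  rw [e1, e2, e3] at h
  exact h

end ExpFamily

end Summit.Ventures.LatticeQCDFlow.Scaling
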